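import Mathlib
import Summits.CriticalPhenomena.PercolationContinuityZ3.Theorems.PercNearOneGluingNoHeavyLowerTailHexMSMatchReservedTerms

/-!
# The reduction strategy for (MS2): monotone moves and block-rank order certificates (hp-7 gen 78)

Support file for crux `stmt-CriticalPhenomena-4575` (route `PercNearOneGluingNoHeavy`), hull-port seat `prim-hp-7` (generation 78);
`--supports stmt-CriticalPhenomena-4575 --as helper`.  No `sorry`.  Memo: `run/shared/lean/prim/prim-hp-7/FROM-prim-hp-7-g78-RECTANGLES-AND-REDUCTIONS.md` §0 (D).

Write `T(P, Q, D₅, D₂) = (P ∪ Q) \\ (P ∪ Q) ∪ P \\ D₅ ∪ Q \\ D₂` for the terms of an (MS2) instance and `R = (P ∪ Q) ∪ D₅ ∪ D₂` for its items.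
The gen-78 census (kit `j287570`: exhaustive `2^[5]`, exhaustive `2^[6]` for `#F ≤ 5`, samples beyond) settles every admissible instance by two MONOTONE
MOVES plus four uniform leaf theorems (tight-or-free, one type, co-star, new-block).  This file records the formal shape of the moves and the most
general ORDER leaf:

* `Reduction.ms2_mono` — **the monotone move.**  If `(P', Q', D₅', D₂')` is a sub-instance (componentwise `⊆`) whose term set loses at least as many
  terms as items, i.e. `#(R \ R') + #T' ≤ #T`, then (MS2) for the sub-instance implies (MS2) for the instance.  The two census moves are the cases
  'drop one designated set owning a private term' (`#(R \ R') ≤ 1`, `#T' + 1 ≤ #T`) and 'drop one member together with the designated sets it alone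
  represents' (`#(R \ R') ≤ 1 + j`, `#T' + 1 + j ≤ #T`).
* `Reduction.ms2_of_erase_designated` — the first move spelled out for a type-5 designated set `d` with a private term `t ∈ T \ T'`.
* `Reduction.ms2_of_blockRank` — **block-rank order certificates.**  For ANY block index `β : Finset α → ℕ` rank the members by `β`, inside a level by
  decreasing cardinality; an injective reservation `τ` (nonempty values in `T`) proves (MS2) as soon as no value is a forward difference — `f \ g` with
  `β f < β g`, or `β f = β g`, `f ≠ g`, `#g ≤ #f` — and `f ⊄ g` whenever `β f < β g`.  `β = [· ∈ Q]` is gen 78's `BlockReserved.ms2_of_blockOrder`,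
  `β ∈ {0,1,2}` the SANDWICH orders `X₁ < Y < X₂` that certify the two irreducible instances of the `2^[6]` sample (memo §3), `β` injective an arbitrary
  linear order (`ReservedTerms.ms2_of_orderCert` itself).
* `Reduction.ms2_of_blockOrder_new1` (appended) — **new second differences plus ONE old option**: the leaf that absorbs the 'prism' obstruction of the
  `2^[6]` zoo (the only irreducible non-leaf kind with at most seven members).
* `Reduction.ms2_of_card_le_card_nonForward` (appended) — **the counting form**: an order certificate exists as soon as the nonempty non-forward terms are at
  least as numerous as the designated sets (no menus).
-/

namespace Summit.CriticalPhenomena.PercolationContinuityZ3.Theorems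

namespace Reduction

open Finset
open scoped FinsetFamily

variable {α : Type*} [DecidableEq α]

/-- **The monotone move** (hp-7 gen 78).  A sub-instance whose term set loses at least as many terms as items transfers (MS2) upward. -/
theorem ms2_mono (P Q D₅ D₂ P' Q' D₅' D₂' : Finset (Finset α))
    (hP : P' ⊆ P) (hQ : Q' ⊆ Q) (hD₅ : D₅' ⊆ D₅) (hD₂ : D₂' ⊆ D₂)
    (hcount : #(((P ∪ Q) ∪ D₅ ∪ D₂) \ ((P' ∪ Q') ∪ D₅' ∪ D₂')) +
        #(((P' ∪ Q') \\ (P' ∪ Q')) ∪ (P' \\ D₅') ∪ (Q' \\ D₂')) ≤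
      #(((P ∪ Q) \\ (P ∪ Q)) ∪ (P \\ D₅) ∪ (Q \\ D₂)))
    (hms2' : #((P' ∪ Q') ∪ D₅' ∪ D₂') ≤ #(((P' ∪ Q') \\ (P' ∪ Q')) ∪ (P' \\ D₅') ∪ (Q' \\ D₂'))) :
    #((P ∪ Q) ∪ D₅ ∪ D₂) ≤ #(((P ∪ Q) \\ (P ∪ Q)) ∪ (P \\ D₅) ∪ (Q \\ D₂)) := by
  classical
  set R := (P ∪ Q) ∪ D₅ ∪ D₂ with hR
  set R' := (P' ∪ Q') ∪ D₅' ∪ D₂' with hR'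
  have hsub : R' ⊆ R := by
    intro r hr
    rcases mem_union.mp hr with hr | hr
    · rcases mem_union.mp hr with hr | hr
      · rcases mem_union.mp hr with hr | hr
        · exact mem_union_left _ (mem_union_left _ (mem_union_left _ (hP hr)))
        · exact mem_union_left _ (mem_union_left _ (mem_union_right _ (hQ hr)))
      · exact mem_union_left _ (mem_union_right _ (hD₅ hr))
    · exact mem_union_right _ (hD₂ hr)
  have hcard : #R = #(R \ R') + #R' := (card_sdiff_add_card_eq_card hsub).symm
  omega

/-- **Dropping a designated set that owns a private term** (hp-7 gen 78; the census move (d), type-5 case — for type 2 exchange the roles).  If some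
term `t` of the instance is not a term of the instance with `d` erased from `D₅`, then (MS2) without `d` implies (MS2).  (No hypothesis `d ∈ D₅` is
needed: for `d ∉ D₅` the two instances coincide and the premise on `t` is vacuous.) -/
theorem ms2_of_erase_designated (P Q D₅ D₂ : Finset (Finset α)) (d t : Finset α)
    (ht : t ∈ ((P ∪ Q) \\ (P ∪ Q)) ∪ (P \\ D₅) ∪ (Q \\ D₂))
    (ht' : t ∉ ((P ∪ Q) \\ (P ∪ Q)) ∪ (P \\ (D₅.erase d)) ∪ (Q \\ D₂))
    (hms2' : #((P ∪ Q) ∪ D₅.erase d ∪ D₂) ≤ #(((P ∪ Q) \\ (P ∪ Q)) ∪ (P \\ (D₅.erase d)) ∪ (Q \\ D₂))) :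
    #((P ∪ Q) ∪ D₅ ∪ D₂) ≤ #(((P ∪ Q) \\ (P ∪ Q)) ∪ (P \\ D₅) ∪ (Q \\ D₂)) := by
  classical
  -- items: at most `d` is lost
  have h1 : #((P ∪ Q) ∪ D₅ ∪ D₂) ≤ #((P ∪ Q) ∪ D₅.erase d ∪ D₂) + 1 := by
    have hsub : (P ∪ Q) ∪ D₅ ∪ D₂ ⊆ insert d ((P ∪ Q) ∪ D₅.erase d ∪ D₂) := by
      intro s hs
      rw [mem_insert]
      by_cases hsd : s = d
      · exact Or.inl hsd
      · right
        rcases mem_union.mp hs with h | h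
        · rcases mem_union.mp h with h | h
          · exact mem_union_left _ (mem_union_left _ h)
          · exact mem_union_left _ (mem_union_right _ (mem_erase.mpr ⟨hsd, h⟩))
        · exact mem_union_right _ h
    exact (card_le_card hsub).trans (card_insert_le _ _)
  -- terms: the sub-instance's terms are terms other than `t`
  have h2 : #(((P ∪ Q) \\ (P ∪ Q)) ∪ (P \\ (D₅.erase d)) ∪ (Q \\ D₂)) + 1 ≤ #(((P ∪ Q) \\ (P ∪ Q)) ∪ (P \\ D₅) ∪ (Q \\ D₂)) := by
    have hsub : ((P ∪ Q) \\ (P ∪ Q)) ∪ (P \\ (D₅.erase d)) ∪ (Q \\ D₂) ⊆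
        (((P ∪ Q) \\ (P ∪ Q)) ∪ (P \\ D₅) ∪ (Q \\ D₂)).erase t := by
      intro s hs
      rw [mem_erase]
      refine ⟨?_, ?_⟩
      · rintro rfl
        exact ht' hs
      · rcases mem_union.mp hs with h | h
        · rcases mem_union.mp h with h | h
          · exact mem_union_left _ (mem_union_left _ h)
          · obtain ⟨p, hp, e, he, rfl⟩ := mem_diffs.mp h
            exact mem_union_left _ (mem_union_right _ (mem_diffs.mpr ⟨p, hp, e, mem_of_mem_erase he, rfl⟩))
        · exact mem_union_right _ h
    have h := card_le_card hsub
    rw [card_erase_of_mem ht] at h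
    have hpos : 0 < #(((P ∪ Q) \\ (P ∪ Q)) ∪ (P \\ D₅) ∪ (Q \\ D₂)) := card_pos.mpr ⟨t, ht⟩
    omega
  omega

/-- **(MS2) from a block-rank order certificate** (hp-7 gen 78).  Let `β` assign a block index to every member; rank members by `β`, inside a block
by decreasing cardinality.  If `τ` is injective on `D₅ ∪ D₂` with nonempty values among the terms, no value is a difference `f \ g` with
`β f < β g` or with `β f = β g`, `f ≠ g`, `#g ≤ #f`, and `f ⊄ g` whenever `β f < β g`, then (MS2) holds for `(P, Q, D₅, D₂)`. -/
theorem ms2_of_blockRank (P Q D₅ D₂ : Finset (Finset α))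
    (hD₅ : D₅ ⊆ P \\ Q) (hD₂ : D₂ ⊆ Q \\ P) (β : Finset α → ℕ) (τ : Finset α → Finset α)
    (hτT : ∀ d ∈ D₅ ∪ D₂, τ d ∈ ((P ∪ Q) \\ (P ∪ Q)) ∪ (P \\ D₅) ∪ (Q \\ D₂))
    (hτ0 : ∀ d ∈ D₅ ∪ D₂, τ d ≠ ∅) (hτinj : Set.InjOn τ ↑(D₅ ∪ D₂))
    (hcont : ∀ f ∈ P ∪ Q, ∀ g ∈ P ∪ Q, β f < β g → ¬ f ⊆ g)
    (hlt : ∀ d ∈ D₅ ∪ D₂, ∀ f ∈ P ∪ Q, ∀ g ∈ P ∪ Q, β f < β g → τ d ≠ f \ g)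
    (heq : ∀ d ∈ D₅ ∪ D₂, ∀ f ∈ P ∪ Q, ∀ g ∈ P ∪ Q, β f = β g → f ≠ g → #g ≤ #f → τ d ≠ f \ g) :
    #((P ∪ Q) ∪ D₅ ∪ D₂) ≤ #(((P ∪ Q) \\ (P ∪ Q)) ∪ (P \\ D₅) ∪ (Q \\ D₂)) := by
  classical
  set F := P ∪ Q with hFdef
  set M : ℕ := F.sup card with hM
  have hcardM : ∀ {f : Finset α}, f ∈ F → #f ≤ M := fun hf => le_sup (f := card) hf
  -- rank: lexicographic (block index, decreasing size)
  let r : Finset α → ℤ := fun f => (β f : ℤ) * ((M : ℤ) + 1) - (#f : ℤ)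
  have hblock : ∀ {f g : Finset α}, f ≠ g → #g ≤ #f → f \ g ≠ ∅ := by
    intro f g hne hle h0
    exact hne (eq_of_subset_of_card_le (sdiff_eq_empty_iff_subset.mp h0) hle)
  refine ReservedTerms.ms2_of_orderCert P Q D₅ D₂ hD₅ hD₂ r τ hτT hτ0 hτinj ?_
  intro f hf g hg hne hr
  have hr' : (β f : ℤ) * ((M : ℤ) + 1) - (#f : ℤ) ≤ (β g : ℤ) * ((M : ℤ) + 1) - (#g : ℤ) := hr
  have hfM := hcardM hf
  have hgM := hcardM hg
  rcases lt_trichotomy (β f) (β g) with hlt' | heq' | hgt'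
  · exact ⟨fun h0 => hcont f hf g hg hlt' (sdiff_eq_empty_iff_subset.mp h0), fun d hd => hlt d hd f hf g hg hlt'⟩
  · have hle : #g ≤ #f := by
      rw [heq'] at hr'
      omega
    exact ⟨hblock hne hle, fun d hd => heq d hd f hf g hg heq' hne hle⟩
  · exfalso
    have h1 : (β g : ℤ) + 1 ≤ (β f : ℤ) := by exact_mod_cast hgt'
    nlinarith


/-! ### Appended (hp-7 gen 78): new second differences plus ONE old option — the leaf that absorbs the 'prism' obstruction

The gen-78 irreducible zoo on `2^[6]` (kit `j288427`, `j288064`) contains exactly one kind of instance that is neither tight-or-free, one-type,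
co-star nor new-block: the PRISMS, e.g. `P = {123,124,134}`, `Q = {235,245,345}`, `D₅ = {1,12,13,14}`, `D₂ = {5,25,35,45}` — four type-5 sets but
only three new second differences `{23,24,34}`; the fourth must be reserved as the OLD difference `2 = 123 \ 134 = 124 \ 134 = 235 \ 345 = 245 \ 345`,
which is legal in the block order `P < Q` once the bottoms `134`, `345` of its representations are ranked first inside their blocks.  One old option
is always orientable this way (the representation digraph of a single nonempty set has no directed path of length two), which gives the leaf below;
with it, every admissible instance on `2^[6]` with at most seven members is a leaf or reduces to one by the two monotone moves (memo §0 (D)). -/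

/-- **New second differences plus one old option** (hp-7 gen 78).  Blocks `P` before `Q`; the type-2 sets are pure and contained in no member of
`P` (so they are reserved as themselves); every type-5 set `d` is re-reserved to a nonempty second difference `σ d ∈ P \\ D₅`, `σ` injective on
`D₅`, each value being either NOT a difference of two members or equal to one fixed set `θ` — a nonempty set that is not a cross difference
`p \ q`, whose same-block representations `f \ g = θ` have bottoms `g` contained in no non-bottom member of that block (automatic for antichain
blocks); and no member of `P` lies inside a member of `Q`.  Then (MS2) holds for `(P, Q, D₅, D₂)`. -/
theorem ms2_of_blockOrder_new1 (P Q D₅ D₂ : Finset (Finset α)) (hPQ : Disjoint P Q)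
    (hD₅ : D₅ ⊆ P \\ Q) (hD₂ : D₂ ⊆ Q \\ P)
    (hpure₂ : ∀ d ∈ D₂, d ∉ (P \\ P) ∪ (Q \\ Q)) (hX2 : ∀ d ∈ D₂, ∀ p ∈ P, ¬ d ⊆ p)
    (hcont : ∀ p ∈ P, ∀ q ∈ Q, ¬ p ⊆ q)
    (θ : Finset α) (hθ : θ ∉ P \\ Q) (hθ0 : θ ≠ ∅)
    (hbotP : ∀ f ∈ P, ∀ g ∈ P, f ≠ g → f \ g = θ → ∀ f' ∈ P, (∀ f'' ∈ P, f'' ≠ f' → f'' \ f' ≠ θ) → ¬ g ⊆ f')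
    (hbotQ : ∀ f ∈ Q, ∀ g ∈ Q, f ≠ g → f \ g = θ → ∀ f' ∈ Q, (∀ f'' ∈ Q, f'' ≠ f' → f'' \ f' ≠ θ) → ¬ g ⊆ f')
    (σ : Finset α → Finset α)
    (hσ : ∀ d ∈ D₅, σ d ∈ P \\ D₅ ∧ σ d ≠ ∅ ∧ (σ d ∉ (P ∪ Q) \\ (P ∪ Q) ∨ σ d = θ))
    (hσinj : Set.InjOn σ ↑D₅) :
    #((P ∪ Q) ∪ D₅ ∪ D₂) ≤ #(((P ∪ Q) \\ (P ∪ Q)) ∪ (P \\ D₅) ∪ (Q \\ D₂)) := by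
  classical
  set F := P ∪ Q with hFdef
  have hPnotQ : ∀ {p : Finset α}, p ∈ P → p ∉ Q := fun hp hq => disjoint_left.mp hPQ hp hq
  have hQnotP : ∀ {q : Finset α}, q ∈ Q → q ∉ P := fun hq hp => disjoint_left.mp hPQ hp hq
  -- membership of differences
  have hdiff : ∀ {f g : Finset α}, f ∈ F → g ∈ F → f \ g ∈ F \\ F := fun hf hg => mem_diffs.mpr ⟨_, hf, _, hg, rfl⟩
  have hPF : ∀ {p : Finset α}, p ∈ P → p ∈ F := fun hp => mem_union_left _ hp
  have hQF : ∀ {q : Finset α}, q ∈ Q → q ∈ F := fun hq => mem_union_right _ hq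
  have hD₂F : ∀ {d : Finset α}, d ∈ D₂ → d ∈ F \\ F := by
    intro d hd
    obtain ⟨q, hq, p, hp, rfl⟩ := mem_diffs.mp (hD₂ hd)
    exact hdiff (hQF hq) (hPF hp)
  -- `θ`, being a value `p \ d`, lies inside a member of `P` whenever it is used; type-2 sets are never values
  have hσD₂ : ∀ {d : Finset α}, d ∈ D₅ → σ d ∉ D₂ := by
    intro d hd h2
    obtain ⟨p, hp, e, -, hpe⟩ := mem_diffs.mp (hσ d hd).1
    exact hX2 _ h2 p hp (hpe ▸ sdiff_subset)
  have hD₅D₂ : ∀ {d : Finset α}, d ∈ D₅ → d ∉ D₂ := by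
    intro d hd5 hd2
    obtain ⟨p, hp, q, -, hpq⟩ := mem_diffs.mp (hD₅ hd5)
    exact hX2 _ hd2 p hp (hpq ▸ sdiff_subset)
  -- tops of `θ`-representations are never bottoms
  have htopbot : ∀ {f g h : Finset α}, f \ g = θ → h \ f = θ → False := by
    intro f g h hfg hhf
    obtain ⟨x, hx⟩ := nonempty_iff_ne_empty.mpr hθ0
    have hx1 : x ∈ f := (mem_sdiff.mp (hfg ▸ hx : x ∈ f \ g)).1
    have hx2 : x ∉ f := (mem_sdiff.mp (hhf ▸ hx : x ∈ h \ f)).2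
    exact hx2 hx1
  -- the block rank
  let bot : Finset (Finset α) → Finset α → Prop := fun B g => ∃ f ∈ B, f ≠ g ∧ f \ g = θ
  let β : Finset α → ℕ := fun g =>
    if g ∈ P then (if bot P g then 0 else 1) else (if bot Q g then 2 else 3)
  have hβP : ∀ {g : Finset α}, g ∈ P → β g = (if bot P g then 0 else 1) := fun hg => by simp only [β, if_pos hg]
  have hβQ : ∀ {g : Finset α}, g ∈ Q → β g = (if bot Q g then 2 else 3) := fun hg => by simp only [β, if_neg (hQnotP hg)]
  have hβP_le : ∀ {g : Finset α}, g ∈ P → β g ≤ 1 := by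
    intro g hg; rw [hβP hg]; split_ifs <;> omega
  have hβQ_ge : ∀ {g : Finset α}, g ∈ Q → 2 ≤ β g := by
    intro g hg; rw [hβQ hg]; split_ifs <;> omega
  -- non-bottom members of a block: no same-block `f''` with `f'' \ f' = θ`
  have hnonbot : ∀ {B : Finset (Finset α)} {f' : Finset α}, ¬ bot B f' → ∀ f'' ∈ B, f'' ≠ f' → f'' \ f' ≠ θ := by
    intro B f' hnb f'' hf'' hne h
    exact hnb ⟨f'', hf'', hne, h⟩
  let τ : Finset α → Finset α := fun d => if d ∈ D₅ then σ d else d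
  have hτ5 : ∀ {d : Finset α}, d ∈ D₅ → τ d = σ d := fun hd => by simp only [τ, if_pos hd]
  have hτ2 : ∀ {d : Finset α}, d ∈ D₂ → τ d = d := fun hd => by simp only [τ, if_neg (fun h => hD₅D₂ h hd)]
  -- a reserved value is never a same-block difference `f \ g` unless it is `θ` with `g` a bottom and `f` a top
  have hval_diff : ∀ {d f g : Finset α}, d ∈ D₅ ∪ D₂ → f ∈ F → g ∈ F → τ d = f \ g →
      (f ∈ P ∧ g ∈ P ∨ f ∈ Q ∧ g ∈ Q) → f \ g = θ := by
    intro d f g hd hf hg h hblk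
    rcases mem_union.mp hd with hd | hd
    · rw [hτ5 hd] at h
      rcases (hσ d hd).2.2 with hnew | hth
      · exact absurd (h ▸ hdiff hf hg) hnew
      · rw [← h, hth]
    · rw [hτ2 hd] at h
      exfalso
      rcases hblk with ⟨hfP, hgP⟩ | ⟨hfQ, hgQ⟩
      · exact hpure₂ d hd (mem_union_left _ (h ▸ mem_diffs.mpr ⟨f, hfP, g, hgP, rfl⟩))
      · exact hpure₂ d hd (mem_union_right _ (h ▸ mem_diffs.mpr ⟨f, hfQ, g, hgQ, rfl⟩))
  refine ms2_of_blockRank P Q D₅ D₂ hD₅ hD₂ β τ ?_ ?_ ?_ ?_ ?_ ?_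
  · -- values are terms
    intro d hd
    rcases mem_union.mp hd with hd | hd
    · rw [hτ5 hd]; exact mem_union_left _ (mem_union_right _ (hσ d hd).1)
    · rw [hτ2 hd]; exact mem_union_left _ (mem_union_left _ (hD₂F hd))
  · -- nonempty values
    intro d hd h0
    rcases mem_union.mp hd with hd | hd
    · rw [hτ5 hd] at h0; exact (hσ d hd).2.1 h0
    · rw [hτ2 hd] at h0
      obtain ⟨q, hq, -, -, -⟩ := mem_diffs.mp (hD₂ hd)
      have h0Q : (∅ : Finset α) ∈ Q \\ Q := mem_diffs.mpr ⟨q, hq, q, hq, (by simp : q \ q = ∅)⟩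
      rw [← h0] at h0Q
      exact hpure₂ d hd (mem_union_right _ h0Q)
  · -- injective
    intro d hd d' hd' h
    simp only [coe_union, Set.mem_union, mem_coe] at hd hd'
    rcases hd with hd | hd <;> rcases hd' with hd' | hd'
    · rw [hτ5 hd, hτ5 hd'] at h; exact hσinj hd hd' h
    · rw [hτ5 hd, hτ2 hd'] at h; exact absurd hd' (h ▸ hσD₂ hd)
    · rw [hτ2 hd, hτ5 hd'] at h; exact absurd hd (h.symm ▸ hσD₂ hd')
    · rw [hτ2 hd, hτ2 hd'] at h; exact h
  · -- containments never point forward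
    intro f hf g hg hlt hsub
    rcases mem_union.mp hf with hfP | hfQ <;> rcases mem_union.mp hg with hgP | hgQ
    · -- both in `P`: `f` is a bottom, `g` is not
      rw [hβP hfP, hβP hgP] at hlt
      by_cases hbf : bot P f
      · by_cases hbg : bot P g
        · rw [if_pos hbf, if_pos hbg] at hlt; omega
        · obtain ⟨f₁, hf₁, hne₁, he₁⟩ := hbf
          exact hbotP f₁ hf₁ f hfP hne₁ he₁ g hgP (hnonbot hbg) hsub
      · rw [if_neg hbf] at hlt; split_ifs at hlt <;> omega
    · exact hcont f hfP g hgQ hsub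
    · have h1 := hβP_le hgP; have h2 := hβQ_ge hfQ; omega
    · rw [hβQ hfQ, hβQ hgQ] at hlt
      by_cases hbf : bot Q f
      · by_cases hbg : bot Q g
        · rw [if_pos hbf, if_pos hbg] at hlt; omega
        · obtain ⟨f₁, hf₁, hne₁, he₁⟩ := hbf
          exact hbotQ f₁ hf₁ f hfQ hne₁ he₁ g hgQ (hnonbot hbg) hsub
      · rw [if_neg hbf] at hlt; split_ifs at hlt <;> omega
  · -- no value is a difference `f \ g` with `β f < β g`
    intro d hd f hf g hg hlt h
    rcases mem_union.mp hf with hfP | hfQ <;> rcases mem_union.mp hg with hgP | hgQ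
    · -- `P`/`P`: then `f \ g = θ`, so `g` is a bottom (rank 0) and `β f < 0` is impossible
      have hth := hval_diff hd hf hg h (Or.inl ⟨hfP, hgP⟩)
      by_cases hfg : f = g
      · exact hθ0 (by rw [← hth, hfg, sdiff_self]; rfl)
      have hbg : bot P g := ⟨f, hfP, hfg, hth⟩
      rw [hβP hgP, if_pos hbg] at hlt
      omega
    · -- `P` before `Q`: a value is never a cross difference `p \ q`
      rcases mem_union.mp hd with hd5 | hd2
      · rw [hτ5 hd5] at h
        rcases (hσ d hd5).2.2 with hnew | hth
        · exact hnew (h ▸ hdiff hf hg)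
        · exact hθ (hth ▸ h ▸ mem_diffs.mpr ⟨f, hfP, g, hgQ, rfl⟩)
      · rw [hτ2 hd2] at h
        exact hX2 d hd2 f hfP (h ▸ sdiff_subset)
    · have h1 := hβP_le hgP; have h2 := hβQ_ge hfQ; omega
    · have hth := hval_diff hd hf hg h (Or.inr ⟨hfQ, hgQ⟩)
      by_cases hfg : f = g
      · exact hθ0 (by rw [← hth, hfg, sdiff_self]; rfl)
      have hbg : bot Q g := ⟨f, hfQ, hfg, hth⟩
      rw [hβQ hgQ, if_pos hbg] at hlt
      have := hβQ_ge hfQ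
      omega
  · -- no value is a same-rank same-block difference
    intro d hd f hf g hg hβeq hne _ h
    rcases mem_union.mp hf with hfP | hfQ <;> rcases mem_union.mp hg with hgP | hgQ
    · have hth := hval_diff hd hf hg h (Or.inl ⟨hfP, hgP⟩)
      have hbg : bot P g := ⟨f, hfP, hne, hth⟩
      have hbf : ¬ bot P f := fun ⟨h', _, _, hh⟩ => htopbot hth hh
      rw [hβP hfP, hβP hgP, if_neg hbf, if_pos hbg] at hβeq
      omega
    · have h1 := hβP_le hfP; have h2 := hβQ_ge hgQ; omega
    · have h1 := hβP_le hgP; have h2 := hβQ_ge hfQ; omega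
    · have hth := hval_diff hd hf hg h (Or.inr ⟨hfQ, hgQ⟩)
      have hbg : bot Q g := ⟨f, hfQ, hne, hth⟩
      have hbf : ¬ bot Q f := fun ⟨h', _, _, hh⟩ => htopbot hth hh
      rw [hβQ hfQ, hβQ hgQ, if_neg hbf, if_pos hbg] at hβeq
      omega


/-! ### Appended (hp-7 gen 78): the counting form of order certificates — menus are irrelevant

`ReservedTerms.ms2_of_orderCert` needs an injective `τ` on `D₅ ∪ D₂` whose values are nonempty terms avoiding the FORWARD differences of the rank
`r` (`f \ g` with `r f ≤ r g`).  Which designated set receives which value plays no role, so such a `τ` exists as soon as the designated sets are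
at most as numerous as the nonempty non-forward terms — a pure counting condition on the rank (memo §7: for an instance, an order certificate
exists iff `max_< #PB(<) + #SD_new ≥ #D`, `PB(<)` = differences all of whose representations are backward, `SD_new` = second differences that
are not differences).  The natural-menu restriction of the gen 76/77 conjectures (INC-nat, C0-nat) was self-imposed. -/

/-- **(MS2) from a rank with enough non-forward terms** (hp-7 gen 78).  If `r` ranks the members so that no earlier member is contained in a later
one, and the nonempty terms of `T = F \\ F ∪ P \\ D₅ ∪ Q \\ D₂` that are not forward differences `f \ g` (`f ≠ g`, `r f ≤ r g`) are at least as
numerous as `D₅ ∪ D₂`, then `#((P ∪ Q) ∪ D₅ ∪ D₂) ≤ #T`. -/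
theorem ms2_of_card_le_card_nonForward {β : Type*} [LinearOrder β] (P Q D₅ D₂ : Finset (Finset α))
    (hD₅ : D₅ ⊆ P \\ Q) (hD₂ : D₂ ⊆ Q \\ P) (r : Finset α → β)
    (hcont : ∀ f ∈ P ∪ Q, ∀ g ∈ P ∪ Q, f ≠ g → r f ≤ r g → ¬ f ⊆ g)
    (hcount : #(D₅ ∪ D₂) ≤ #((((P ∪ Q) \\ (P ∪ Q)) ∪ (P \\ D₅) ∪ (Q \\ D₂)).filter fun t =>
        t ≠ ∅ ∧ ∀ f ∈ P ∪ Q, ∀ g ∈ P ∪ Q, f ≠ g → r f ≤ r g → t ≠ f \ g)) :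
    #((P ∪ Q) ∪ D₅ ∪ D₂) ≤ #(((P ∪ Q) \\ (P ∪ Q)) ∪ (P \\ D₅) ∪ (Q \\ D₂)) := by
  classical
  set T : Finset (Finset α) := ((P ∪ Q) \\ (P ∪ Q)) ∪ (P \\ D₅) ∪ (Q \\ D₂) with hT
  set R : Finset (Finset α) := T.filter fun t => t ≠ ∅ ∧ ∀ f ∈ P ∪ Q, ∀ g ∈ P ∪ Q, f ≠ g → r f ≤ r g → t ≠ f \ g with hR
  -- an injection of the designated sets into the reservable terms, by cardinality alone
  have hle : (↑(D₅ ∪ D₂) : Set (Finset α)).encard ≤ (↑R : Set (Finset α)).encard := by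
    rw [Set.encard_coe_eq_coe_finsetCard, Set.encard_coe_eq_coe_finsetCard]
    exact_mod_cast hcount
  obtain ⟨τ, hτR, hτinj⟩ := Set.Finite.exists_injOn_of_encard_le (finite_toSet (D₅ ∪ D₂)) hle
  have hτ : ∀ d ∈ D₅ ∪ D₂, τ d ∈ R := fun d hd => by
    have := hτR (mem_coe.mpr hd)
    simpa using this
  refine ReservedTerms.ms2_of_orderCert P Q D₅ D₂ hD₅ hD₂ r τ ?_ ?_ hτinj ?_
  · intro d hd; exact (mem_filter.mp (hτ d hd)).1
  · intro d hd; exact (mem_filter.mp (hτ d hd)).2.1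
  · intro f hf g hg hne hr
    refine ⟨fun h0 => hcont f hf g hg hne hr (sdiff_eq_empty_iff_subset.mp h0), fun d hd => ?_⟩
    exact (mem_filter.mp (hτ d hd)).2.2 f hf g hg hne hr

end Reduction

end Summit.CriticalPhenomena.PercolationContinuityZ3.Theorems
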